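import Mathlib.Analysis.Calculus.Deriv.MeanValue
import Mathlib.Analysis.SpecialFunctions.Log.Basic
import Summits.QuantumFields.BalabanUV.Beta.EriceFlowEnclosureSlowVariationC1

/-!
# Beta / EriceFlowEnclosureCesaroTauberian — THE (C,1) TAUBERIAN THEOREM AT 0⁺ IN ANTIDERIVATIVE FORM: A SLOWLY OSCILLATING FUNCTION WITH A
# CESÀRO MEAN CONVERGES (pure [folklore] SERVICE for P2 #50e; Mathlib + P2 #47c only).  For φ : ]0, δ[ → ℝ SLOWLY OSCILLATING at 0⁺ —
#        **(SO)  ∀ ε > 0 ∃ q > 1 ∃ τ > 0:  |φ u − φ t| ≤ ε  whenever 0 < t ≤ τ and t ≤ u ≤ q·t**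
# (R. Schmidt's «langsam oszillierend», the two-sided case, read multiplicatively towards 0⁺) — and Φ with Φ′ = φ on ]0, δ[:
#        **Φ(t)∕t → m at 0⁺   ⟹   φ(t) → m at 0⁺**   (`tendsto_of_cesaro_slowlyOscillating`; and already under R. Schmidt's ONE-SIDED slow
# decrease `φ t − ε ≤ φ u` for t ≤ u ≤ qt near 0 — `tendsto_of_cesaro_slowlyDecreasing`, HEADLINE);
# (SO) implies the lineage's scale-g⁴ SLOW-VARIATION clause (SV) of row L84 for EVERY M (`slowVariation_of_slowlyOscillating`), a limit at 0⁺
# implies (SO) (`slowlyOscillating_of_tendsto`), a log-Lipschitz function (|φ a − φ b| ≤ K·log(a∕b), e.g. sin∘log) is (SO)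
# (`slowlyOscillating_of_logLip`), and for an integrable φ with the FTC at every point of ]0, δ[: **(1∕t)∫₀ᵗ φ → m ⟺ φ → m** under (SO)
# (`cesaro_iff_tendsto_of_slowlyOscillating`; ⟸ is P2 #47c `cesaro_of_tendsto`, no clause)
# (β-flow team, prover 2 = lower ∕ positivity side, unit `b2b-balaban-beta-bflow-p2`, gen 33; module P2 #50d; no Erice sentence occurs)

HONEST FRAMING (page 1 of everything the β sub-cell writes): discharging `BetaPertH` makes Bałaban's UV stability UNCONDITIONAL — a
real constructive-QFT result; it is NOT the continuum limit and NOT the Clay problem.  HONEST DEPENDENCY (cell reorg 2026-08-19,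
verbatim): «continuum YM on T⁴ ⇐ BetaPertH ∧ nine spine estimates (0/9 proved); BetaPertH ⇐ (D1) ∧ (D4) ∧ CAP+tail; G-an2-4 gates
asym, D1 and NE2/3/4.»  THIS MODULE DISCHARGES NOTHING and quotes nothing: [folklore] real analysis about two real functions φ, Φ (the
classical Tauberian theorem for Cesàro means under two-sided slow oscillation — R. Schmidt, Math. Z. 22 (1925); G. H. Hardy, Divergent
Series, §6.2 — in the form needed at 0⁺; Mathlib has no Tauberian theorem of this type, `lean search Tauberian|SlowlyOscillat|Cesaro`:
only Karamata-type facts under positivity and NAMED (unproved) Móricz facts in `Literature/Analysis/Asymptotics/`).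

THE POINT.  Fix ε, take q, τ from the slow-decrease condition.  UPPER: on [t, qt] the derivative of Φ is φ ≥ φ(t) − ε, so the DIFFERENCE
QUOTIENT `Q⁺(t) := (Φ(qt) − Φ(t))∕((q − 1)t) = (q·Φ(qt)∕(qt) − Φ(t)∕t)∕(q − 1) → m` dominates φ(t) − ε; LOWER: every s ∈ [t∕q, t] has t ∈ [s, qs],
so on [t∕q, t] the derivative of Φ is ≤ φ(t) + ε and `Q⁻(t) := (Φ(t) − Φ(t∕q))∕((1 − 1∕q)t) → m` is dominated by φ(t) + ε.  Hence
`m − ε ≤ liminf φ ≤ limsup φ ≤ m + ε` for every ε (Mathlib's monotonicity-from-derivative inequalities on convex sets).  Slow oscillation is the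
two-sided case.  (SO) ⟹ (SV): `a − b ≤ M a²` and `a ≤ (q − 1)∕(q(|M| + 1))` force `a ≤ q·b`.

WHAT THIS FILE PROVES (0 sorry, 0 def): §1 HEADLINE **`tendsto_of_cesaro_slowlyDecreasing`** (one-sided), **`tendsto_of_cesaro_slowlyOscillating`**; §2 **`slowVariation_of_slowlyOscillating`**,
`slowlyOscillating_of_tendsto`, `slowlyOscillating_of_logLip`; §3 **`cesaro_iff_tendsto_of_slowlyOscillating`**.
NOT CLAIMED: Tauberian theorems for other means (logarithmic, Abel); anything about β-functions (the consumer P2 #50e instantiates φ = r∕u²);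
`BetaPertH`; continuum; Clay.
-/

namespace Summit.QuantumFields.BalabanUV.Beta.EriceFlowEnclosureCesaroTauberian

open Set Filter Topology MeasureTheory
open Summit.QuantumFields.BalabanUV.Beta.EriceFlowEnclosureSlowVariationC1 (cesaro_of_tendsto)

noncomputable section

/-! ## §1 Slow decrease (one-sided) or slow oscillation + Cesàro mean ⟹ convergence -/

/-- **THE (C,1) TAUBERIAN THEOREM AT 0⁺ UNDER ONE-SIDED SLOW DECREASE (HEADLINE; antiderivative form).**  If `Φ′ = φ` on ]0, δ[ (δ > 0),
`Φ(t)∕t → m` as t → 0⁺, and φ is SLOWLY DECREASING towards 0⁺ — for every ε > 0 there are q > 1 and τ > 0 with `φ t − ε ≤ φ u` whenever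
`0 < t ≤ τ` and `t ≤ u ≤ q·t` (R. Schmidt's one-sided condition, read multiplicatively towards 0⁺) — then **`φ(t) → m` as t → 0⁺**.
UPPER bound: on [t, qt] the derivative of Φ is ≥ φ t − ε, so `φ t − ε ≤ (Φ(qt) − Φ t)∕((q − 1)t) → m`; LOWER bound: on [t∕q, t] every base
point s has t ∈ [s, qs], so the derivative of Φ is ≤ φ t + ε there and `(Φ t − Φ(t∕q))∕((1 − 1∕q)t) ≤ φ t + ε`, the quotient again → m
(Mathlib's one-dimensional monotonicity-from-derivative inequalities on a convex set). [folklore] (R. Schmidt 1925; Hardy, Divergent Series §6.2) -/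
theorem tendsto_of_cesaro_slowlyDecreasing {Φ φ : ℝ → ℝ} {δ m : ℝ} (hδ : 0 < δ)
    (hΦ : ∀ t ∈ Ioo 0 δ, HasDerivAt Φ (φ t) t)
    (hces : Tendsto (fun t => Φ t / t) (𝓝[>] 0) (𝓝 m))
    (hsd : ∀ ε > 0, ∃ q > (1:ℝ), ∃ τ > (0:ℝ), ∀ t ∈ Ioc 0 τ, ∀ u ∈ Icc t (q * t), φ t - ε ≤ φ u) :
    Tendsto φ (𝓝[>] 0) (𝓝 m) := by
  -- Φ is continuous on every [a, b] ⊆ ]0, δ[ and differentiable inside, with deriv Φ = φ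
  have hcont : ∀ a b : ℝ, 0 < a → b < δ → ContinuousOn Φ (Icc a b) := fun a b ha hb x hx =>
    (hΦ x ⟨ha.trans_le hx.1, hx.2.trans_lt hb⟩).continuousAt.continuousWithinAt
  have hdiff : ∀ a b : ℝ, 0 < a → b < δ → DifferentiableOn ℝ Φ (interior (Icc a b)) := by
    intro a b ha hb x hx
    rw [interior_Icc] at hx
    exact (hΦ x ⟨ha.trans hx.1, hx.2.trans hb⟩).differentiableAt.differentiableWithinAt
  have hscale : ∀ c : ℝ, 0 < c → Tendsto (fun t : ℝ => c * t) (𝓝[>] 0) (𝓝[>] 0) := by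
    intro c hc
    refine tendsto_nhdsWithin_iff.mpr ⟨?_, ?_⟩
    · have h : Tendsto (fun t : ℝ => c * t) (𝓝 0) (𝓝 (c * 0)) := tendsto_id.const_mul c
      rw [mul_zero] at h
      exact h.mono_left nhdsWithin_le_nhds
    · filter_upwards [self_mem_nhdsWithin] with t ht
      exact mul_pos hc ht
  refine tendsto_order.2 ⟨fun a ha => ?_, fun a ha => ?_⟩
  · -- LOWER bound with ε = (m − a)∕2 on [t∕q, t]
    obtain ⟨q, hq, τ, hτ, hosc⟩ := hsd ((m - a) / 2) (by linarith)
    have hq0 : 0 < q := by linarith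
    have hQ : Tendsto (fun t => (Φ t - Φ (q⁻¹ * t)) / ((1 - q⁻¹) * t)) (𝓝[>] 0) (𝓝 m) := by
      have h1 : Tendsto (fun t => Φ (q⁻¹ * t) / (q⁻¹ * t)) (𝓝[>] 0) (𝓝 m) := hces.comp (hscale q⁻¹ (by positivity))
      have h2 := (hces.sub (h1.const_mul q⁻¹)).div_const (1 - q⁻¹)
      have hq1 : (1 : ℝ) - q⁻¹ ≠ 0 := by
        have : q⁻¹ < 1 := inv_lt_one_of_one_lt₀ hq
        linarith
      have e : (m - q⁻¹ * m) / (1 - q⁻¹) = m := by rw [div_eq_iff hq1]; ring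
      rw [e] at h2
      refine h2.congr' ?_
      filter_upwards [self_mem_nhdsWithin] with t ht
      have ht0 : (t:ℝ) ≠ 0 := ne_of_gt ht
      have hq' : (q:ℝ) ≠ 0 := hq0.ne'
      field_simp
    have hQev := (tendsto_order.1 hQ).1 (m - (m - a) / 2) (by linarith)
    filter_upwards [hQev, Ioo_mem_nhdsGT (lt_min hτ hδ)] with t hQt ht
    have ht0 : 0 < t := ht.1
    have htτ : t ≤ τ := (ht.2.trans_le (min_le_left _ _)).le
    have htδ : t < δ := ht.2.trans_le (min_le_right _ _)
    have htq0 : 0 < q⁻¹ * t := by positivity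
    have htq : q⁻¹ * t ≤ t := by
      have : q⁻¹ ≤ 1 := inv_le_one_of_one_le₀ hq.le
      nlinarith
    -- deriv Φ ≤ φ t + ε on the interior of [t∕q, t]
    have hbound : ∀ x ∈ interior (Icc (q⁻¹ * t) t), deriv Φ x ≤ φ t + (m - a) / 2 := by
      intro x hx
      rw [interior_Icc] at hx
      have hx0 : 0 < x := htq0.trans hx.1
      rw [(hΦ x ⟨hx0, hx.2.trans htδ⟩).deriv]
      have hxt : t ≤ q * x := by
        have := mul_lt_mul_of_pos_left hx.1 hq0
        rw [← mul_assoc, mul_inv_cancel₀ hq0.ne', one_mul] at this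
        exact this.le
      have h := hosc x ⟨hx0, hx.2.le.trans htτ⟩ t ⟨hx.2.le, hxt⟩
      linarith
    have hmv := Convex.image_sub_le_mul_sub_of_deriv_le (convex_Icc (q⁻¹ * t) t) (hcont _ _ htq0 htδ) (hdiff _ _ htq0 htδ) hbound
      (q⁻¹ * t) (left_mem_Icc.mpr htq) t (right_mem_Icc.mpr htq) htq
    -- (Φ t − Φ(t∕q))∕((1 − 1∕q)t) ≤ φ t + ε
    have hden : 0 < (1 - q⁻¹) * t := by
      have : q⁻¹ < 1 := inv_lt_one_of_one_lt₀ hq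
      nlinarith
    have hQle : (Φ t - Φ (q⁻¹ * t)) / ((1 - q⁻¹) * t) ≤ φ t + (m - a) / 2 := by
      rw [div_le_iff₀ hden]
      calc Φ t - Φ (q⁻¹ * t) ≤ (φ t + (m - a) / 2) * (t - q⁻¹ * t) := hmv
        _ = (φ t + (m - a) / 2) * ((1 - q⁻¹) * t) := by ring
    linarith
  · -- UPPER bound with ε = (a − m)∕2 on [t, qt]
    obtain ⟨q, hq, τ, hτ, hosc⟩ := hsd ((a - m) / 2) (by linarith)
    have hq0 : 0 < q := by linarith
    have hq1 : q - 1 ≠ 0 := (sub_pos.mpr hq).ne'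
    have hQ : Tendsto (fun t => (Φ (q * t) - Φ t) / ((q - 1) * t)) (𝓝[>] 0) (𝓝 m) := by
      have h1 : Tendsto (fun t => Φ (q * t) / (q * t)) (𝓝[>] 0) (𝓝 m) := hces.comp (hscale q hq0)
      have h2 := ((h1.const_mul q).sub hces).div_const (q - 1)
      have e : (q * m - m) / (q - 1) = m := by field_simp
      rw [e] at h2
      refine h2.congr' ?_
      filter_upwards [self_mem_nhdsWithin] with t ht
      have ht0 : (t:ℝ) ≠ 0 := ne_of_gt ht
      field_simp
    have hQev := (tendsto_order.1 hQ).2 (m + (a - m) / 2) (by linarith)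
    have hτ' : 0 < min τ (δ / q) := lt_min hτ (by positivity)
    filter_upwards [hQev, Ioo_mem_nhdsGT hτ'] with t hQt ht
    have ht0 : 0 < t := ht.1
    have htτ : t ≤ τ := (ht.2.trans_le (min_le_left _ _)).le
    have hqtδ : q * t < δ := by
      have h1 : t < δ / q := ht.2.trans_le (min_le_right _ _)
      calc q * t < q * (δ / q) := mul_lt_mul_of_pos_left h1 hq0
        _ = δ := by field_simp
    have htq : t ≤ q * t := by nlinarith
    have hbound : ∀ x ∈ interior (Icc t (q * t)), φ t - (a - m) / 2 ≤ deriv Φ x := by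
      intro x hx
      rw [interior_Icc] at hx
      rw [(hΦ x ⟨ht0.trans hx.1, hx.2.trans hqtδ⟩).deriv]
      exact hosc t ⟨ht0, htτ⟩ x ⟨hx.1.le, hx.2.le⟩
    have hmv := Convex.mul_sub_le_image_sub_of_le_deriv (convex_Icc t (q * t)) (hcont _ _ ht0 hqtδ) (hdiff _ _ ht0 hqtδ) hbound
      t (left_mem_Icc.mpr htq) (q * t) (right_mem_Icc.mpr htq) htq
    have hden : 0 < (q - 1) * t := mul_pos (sub_pos.mpr hq) ht0
    have hQge : φ t - (a - m) / 2 ≤ (Φ (q * t) - Φ t) / ((q - 1) * t) := by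
      rw [le_div_iff₀ hden]
      calc (φ t - (a - m) / 2) * ((q - 1) * t) = (φ t - (a - m) / 2) * (q * t - t) := by ring
        _ ≤ Φ (q * t) - Φ t := hmv
    linarith

/-- **THE (C,1) TAUBERIAN THEOREM AT 0⁺ UNDER SLOW OSCILLATION** (the two-sided case of `tendsto_of_cesaro_slowlyDecreasing`).  If `Φ′ = φ` on
]0, δ[, `Φ(t)∕t → m` at 0⁺, and φ is SLOWLY OSCILLATING at 0⁺ — for every ε > 0 there are q > 1 and τ > 0 with `|φ u − φ t| ≤ ε` whenever
`0 < t ≤ τ` and `t ≤ u ≤ q·t` — then **`φ(t) → m` as t → 0⁺**. [folklore] (R. Schmidt 1925, two-sided case; Hardy, Divergent Series §6.2) -/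
theorem tendsto_of_cesaro_slowlyOscillating {Φ φ : ℝ → ℝ} {δ m : ℝ} (hδ : 0 < δ)
    (hΦ : ∀ t ∈ Ioo 0 δ, HasDerivAt Φ (φ t) t)
    (hces : Tendsto (fun t => Φ t / t) (𝓝[>] 0) (𝓝 m))
    (hso : ∀ ε > 0, ∃ q > (1:ℝ), ∃ τ > (0:ℝ), ∀ t ∈ Ioc 0 τ, ∀ u ∈ Icc t (q * t), |φ u - φ t| ≤ ε) :
    Tendsto φ (𝓝[>] 0) (𝓝 m) := by
  refine tendsto_of_cesaro_slowlyDecreasing hδ hΦ hces fun ε hε => ?_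
  obtain ⟨q, hq, τ, hτ, hosc⟩ := hso ε hε
  refine ⟨q, hq, τ, hτ, fun t ht u hu => ?_⟩
  have h := (abs_le.mp (hosc t ht u hu)).1
  linarith

/-! ## §2 The Tauberian class: it contains the convergent functions and sits inside the slow-variation clause -/

/-- **SLOW OSCILLATION IMPLIES THE SLOW-VARIATION CLAUSE (SV) OF ROW L84, FOR EVERY SCALE CONSTANT M**: if φ is slowly oscillating at 0⁺
then for every ε > 0 there is τ > 0 with `|φ a − φ b| ≤ ε` whenever `0 < b ≤ a ≤ τ` and `a − b ≤ M·a²` (for `a ≤ (q − 1)∕(q(|M| + 1))` the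
gap condition forces `a ≤ q·b`).  The converse fails: P2 #47e's `cos((√u)⁻¹)` is (SV) (C¹ road) but not slowly oscillating (P2 #50e). [folklore] -/
theorem slowVariation_of_slowlyOscillating {φ : ℝ → ℝ} {M : ℝ}
    (hso : ∀ ε > 0, ∃ q > (1:ℝ), ∃ τ > (0:ℝ), ∀ t ∈ Ioc 0 τ, ∀ u ∈ Icc t (q * t), |φ u - φ t| ≤ ε) :
    ∀ ε > 0, ∃ τ > 0, ∀ a ∈ Ioc 0 τ, ∀ b ∈ Ioc 0 τ, b ≤ a → a - b ≤ M * a ^ 2 → |φ a - φ b| ≤ ε := by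
  intro ε hε
  obtain ⟨q, hq, τ, hτ, hosc⟩ := hso ε hε
  have hq0 : 0 < q := by linarith
  have hM1 : 0 < |M| + 1 := by positivity
  set τ' : ℝ := min τ ((q - 1) / (q * (|M| + 1))) with hτ'
  have hτ'pos : 0 < τ' := lt_min hτ (by
    have : 0 < q - 1 := sub_pos.mpr hq
    positivity)
  refine ⟨τ', hτ'pos, fun a ha b hb hba hgap => ?_⟩
  have ha0 : 0 < a := ha.1
  have hb0 : 0 < b := hb.1
  have haτ : a ≤ (q - 1) / (q * (|M| + 1)) := ha.2.trans (min_le_right _ _)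
  -- the gap condition forces a ≤ q·b
  have hgap' : a - b ≤ (|M| + 1) * a * a := by
    have h1 : M * a ^ 2 ≤ (|M| + 1) * a ^ 2 := by nlinarith [le_abs_self M, sq_nonneg a]
    nlinarith
  have hkey : (|M| + 1) * a ≤ (q - 1) / q := by
    have h := mul_le_mul_of_nonneg_left haτ hM1.le
    calc (|M| + 1) * a ≤ (|M| + 1) * ((q - 1) / (q * (|M| + 1))) := h
      _ = (q - 1) / q := by field_simp
  have haqb : a ≤ q * b := by
    have h1 : a - b ≤ (q - 1) / q * a := by
      calc a - b ≤ (|M| + 1) * a * a := hgap'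
        _ ≤ (q - 1) / q * a := mul_le_mul_of_nonneg_right hkey ha0.le
    have h2 : (q - 1) / q * a = a - a / q := by field_simp
    rw [h2] at h1
    have h3 : a / q ≤ b := by linarith
    calc a = q * (a / q) := by field_simp
      _ ≤ q * b := mul_le_mul_of_nonneg_left h3 hq0.le
  have hbτ : b ∈ Ioc 0 τ := ⟨hb0, hb.2.trans (min_le_left _ _)⟩
  exact hosc b hbτ a ⟨hba, haqb⟩

/-- **A LIMIT AT 0⁺ IMPLIES SLOW OSCILLATION** (q = 2: both values are within ε∕2 of the limit near 0). [folklore] -/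
theorem slowlyOscillating_of_tendsto {φ : ℝ → ℝ} {L : ℝ} (hφ : Tendsto φ (𝓝[>] 0) (𝓝 L)) :
    ∀ ε > 0, ∃ q > (1:ℝ), ∃ τ > (0:ℝ), ∀ t ∈ Ioc 0 τ, ∀ u ∈ Icc t (q * t), |φ u - φ t| ≤ ε := by
  intro ε hε
  obtain ⟨τ, hτ, hb⟩ := (nhdsGT_basis_Ioc (0:ℝ)).eventually_iff.mp ((Metric.tendsto_nhds.mp hφ) (ε / 2) (half_pos hε))
  refine ⟨2, by norm_num, τ / 2, half_pos hτ, fun t ht u hu => ?_⟩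
  have ht' : t ∈ Ioc 0 τ := ⟨ht.1, ht.2.trans (by linarith)⟩
  have hu' : u ∈ Ioc 0 τ := ⟨ht.1.trans_le hu.1, hu.2.trans (by linarith [ht.2])⟩
  have h1 := hb ht'
  have h2 := hb hu'
  rw [Real.dist_eq] at h1 h2
  calc |φ u - φ t| = |(φ u - L) - (φ t - L)| := by ring_nf
    _ ≤ |φ u - L| + |φ t - L| := abs_sub _ _
    _ ≤ ε := by linarith

/-- **A LOG-LIPSCHITZ FUNCTION IS SLOWLY OSCILLATING**: if `|φ u − φ t| ≤ K·log(u∕t)` for `0 < t ≤ u < δ` (K > 0; e.g. φ = sin∘log, K = 1 —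
gen 28's log-periodic toy), then φ is slowly oscillating at 0⁺ (q := exp(ε∕K)).  Such a φ need not have a Cesàro mean; with one it converges. [folklore] -/
theorem slowlyOscillating_of_logLip {φ : ℝ → ℝ} {K δ : ℝ} (hK : 0 < K) (hδ : 0 < δ)
    (hlip : ∀ t u : ℝ, 0 < t → t ≤ u → u < δ → |φ u - φ t| ≤ K * Real.log (u / t)) :
    ∀ ε > 0, ∃ q > (1:ℝ), ∃ τ > (0:ℝ), ∀ t ∈ Ioc 0 τ, ∀ u ∈ Icc t (q * t), |φ u - φ t| ≤ ε := by
  intro ε hε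
  set q : ℝ := Real.exp (ε / K) with hq
  have hq1 : 1 < q := by
    rw [hq]
    exact Real.one_lt_exp_iff.mpr (by positivity)
  have hq0 : 0 < q := by linarith
  refine ⟨q, hq1, δ / (2 * q), by positivity, fun t ht u hu => ?_⟩
  have ht0 : 0 < t := ht.1
  have huδ : u < δ := by
    calc u ≤ q * t := hu.2
      _ ≤ q * (δ / (2 * q)) := mul_le_mul_of_nonneg_left ht.2 hq0.le
      _ = δ / 2 := by field_simp
      _ < δ := by linarith
  have h1 := hlip t u ht0 hu.1 huδ
  have h2 : Real.log (u / t) ≤ ε / K := by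
    have hut : u / t ≤ q := by rw [div_le_iff₀ ht0]; exact hu.2
    have hut0 : 0 < u / t := div_pos (ht0.trans_le hu.1) ht0
    calc Real.log (u / t) ≤ Real.log q := Real.log_le_log hut0 hut
      _ = ε / K := by rw [hq, Real.log_exp]
  calc |φ u - φ t| ≤ K * Real.log (u / t) := h1
    _ ≤ K * (ε / K) := mul_le_mul_of_nonneg_left h2 hK.le
    _ = ε := by field_simp

/-! ## §3 Under slow oscillation the Cesàro mean and the limit are the same datum -/

/-- **CESÀRO MEAN ⟺ LIMIT IN THE TAUBERIAN CLASS.**  If φ is interval-integrable on [0, t] for t ∈ ]0, δ], `s ↦ ∫₀ˢ φ` has derivative φ(t) at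
every t ∈ ]0, δ[, and φ is slowly oscillating at 0⁺, then for every m: **`(1∕t)∫₀ᵗ φ → m ⟺ φ → m` at 0⁺** (⟹ §1; ⟸ P2 #47c `cesaro_of_tendsto`,
which needs no clause). [folklore] -/
theorem cesaro_iff_tendsto_of_slowlyOscillating {φ : ℝ → ℝ} {δ : ℝ} (hδ : 0 < δ)
    (hint : ∀ t ∈ Ioc 0 δ, IntervalIntegrable φ volume 0 t)
    (hFTC : ∀ t ∈ Ioo 0 δ, HasDerivAt (fun s => ∫ v in (0:ℝ)..s, φ v) (φ t) t)
    (hso : ∀ ε > 0, ∃ q > (1:ℝ), ∃ τ > (0:ℝ), ∀ t ∈ Ioc 0 τ, ∀ u ∈ Icc t (q * t), |φ u - φ t| ≤ ε) (m : ℝ) :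
    Tendsto (fun t => (∫ v in (0:ℝ)..t, φ v) / t) (𝓝[>] 0) (𝓝 m) ↔ Tendsto φ (𝓝[>] 0) (𝓝 m) :=
  ⟨fun h => tendsto_of_cesaro_slowlyOscillating hδ hFTC h hso, fun h => cesaro_of_tendsto hδ hint h⟩

end

end Summit.QuantumFields.BalabanUV.Beta.EriceFlowEnclosureCesaroTauberian
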